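import Mathlib
import HarnessLib
import Literature.Analysis.FluidPDE.KochTataru
import Literature.Analysis.FluidPDE.KochTataruKernel
import Literature.Analysis.FluidPDE.NSBoundedMildOseen
import Literature.Analysis.FluidPDE.NSBoundedMildOseenDuhamel
import Literature.Analysis.FluidPDE.OseenDuhamelLowFrequency
import Literature.Analysis.FluidPDE.FujitaKatoHeatWeights
import Literature.Analysis.FluidPDE.ForcedHeatDuhamelHolder
import Summits.NavierStokesRegularity.NavierStokesRegularity.Theorems.QuarterLogPincerQuietCollarOseenHalfMoment

/-!
# Route `QuarterLogPincer`, crux `TypeIQuantSubcubicExp` (stmt-NavierStokesRegularity-24077), line `quiet_collar` — towards QP2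
# (log-weighted typing `StubCutPairLog`), module M1b-sup: THE OSEEN COMMUTATOR OF THE CUT REFERENCE IN SUP NORM

The second commutator in the mild defect of the cut reference `V = χ·ṽ` (`…QuietCollarCutReference.mildDefect_cutRef_eq`),
`O(t,x) = χ(x)·B₀(ṽ,ṽ)(t,x) − B₀(χṽ,χṽ)(t,x)`, `B₀ = oseenDuhamel 1 0`, is ONE absolutely convergent integral over
`(0,t) × ℝ³` with the weight `χ(x) − χ(y)²` (bilinearity of Koch–Tataru's kernel `K`):

* `oseenCommutator_eq_integral_prod` — `O(t,x) = ∫_{(0,t)×ℝ³} (χ(x) − χ(y)²)·K(t−τ,x−y)[ṽ(τ,y),ṽ(τ,y)] d(τ,y)` for a bounded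
  measurable field and a measurable weight `|χ| ≤ 1`;
* `abs_weight_le` — the weight splits as `|χ(x) − χ(y)²| ≤ |χ(x) − χ(y)| + χ(y)(1 − χ(y))` (`0 ≤ χ ≤ 1`): a COMMUTATOR part,
  `≤ min(1, Lχ|x−y|) ≤ (Lχ|x−y|)^{1/2}` for an `Lχ`-Lipschitz cut-off (tree `min_one_le_rpow_half`), and a TRANSITION part
  living where `0 < χ < 1`, i.e. on the quiet collar;
* `norm_oseenCommutator_le` — **THE SUP BOUND**: if `‖ṽ(τ,y)‖ ≤ A` on `(0,t) × ℝ³` and `‖ṽ(τ,y)‖ ≤ η_c` wherever `0 < χ(y) < 1`,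
  then `‖O(t,x)‖ ≤ C₀·(Lχ^{1/2}·A²·t^{3/4} + η_c²·t^{1/2})` with an absolute `C₀` (the half moment of the Oseen majorant
  `∫k(σ,z)|z|^{1/2}dz = C_K m_{1/2} σ^{−1/4}`, `…QuietCollarOseenHalfMoment`, and `∫₀ᵗ(t−τ)^{−1/4}dτ = (4/3)t^{3/4}`; the mass
  `∫k(σ,z)dz = m σ^{−1/2}` and `∫₀ᵗ(t−τ)^{−1/2}dτ = 2t^{1/2}`).  For the cut reference of a Type-I field on `[0,1−ε]`
  (`A = M ε^{−1/2}`, `Lχ = C₁/L`, `η_c = ηq/(1+log r)`) this is `≤ C·(M²ε^{−1}L^{−1/2} + ηq²)` — polynomially small in the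
  collar width `L`, UNIFORMLY IN THE RADIUS `r`.

r-INDEPENDENT groundwork for QP2 (DIRECTOR-NS KEY-NS #187).  HONEST FRAME: an elementary kernel estimate about a hypothetical
field; nothing here bears on 24077, W7 or Navier–Stokes regularity (OPEN).  pub-ns-dss typer (g37), `--supports 24077`.
-/

noncomputable section

set_option linter.dupNamespace false

namespace Summit.NavierStokesRegularity.NavierStokesRegularity.Cruxes.TypeIQuantSubcubicExp.QuietCollar

open MeasureTheory Set Function Filter Real Metric
open scoped ENNReal NNReal Topology
open Literature.Analysis Literature.Analysis.FluidPDE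

/-! ### The commutator as one product integral -/

/-- **THE OSEEN COMMUTATOR AS ONE ABSOLUTELY CONVERGENT INTEGRAL**: for a field `u` measurable and bounded on `(0,t) × ℝ³` and a
measurable weight `χ` with `|χ| ≤ 1`,
`χ(x)·B₀(u,u)(t,x) − B₀(χu,χu)(t,x) = ∫_{(0,t)×ℝ³} (χ(x) − χ(y)²)·K(t−τ,x−y)[u(τ,y),u(τ,y)] d(τ,y)`
(Fubini for both Duhamel integrals, `oseenDuhamel_eq_integral_prod_of_bound`, and bilinearity of `K`). [folklore] -/
theorem oseenCommutator_eq_integral_prod {u : ℝ → EuclideanSpace ℝ (Fin 3) → EuclideanSpace ℝ (Fin 3)}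
    {χ : EuclideanSpace ℝ (Fin 3) → ℝ} {t U : ℝ} (ht : 0 < t)
    (hu : AEStronglyMeasurable (uncurry u) (volume.restrict (Ioo 0 t ×ˢ univ))) (hχm : Measurable χ)
    (huU : ∀ τ ∈ Ioo 0 t, ∀ y, ‖u τ y‖ ≤ U) (hU : 0 ≤ U) (hχ1 : ∀ y, |χ y| ≤ 1) (x : EuclideanSpace ℝ (Fin 3)) :
    χ x • oseenDuhamel 1 0 u u t x - oseenDuhamel 1 0 (fun τ y => χ y • u τ y) (fun τ y => χ y • u τ y) t x =
      ∫ p, (χ x - χ p.2 * χ p.2) • oseenKernel (1 * (t - p.1)) (x - p.2) (u p.1 p.2) (u p.1 p.2)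
        ∂((volume.restrict (Ioo 0 t)).prod (volume : Measure (EuclideanSpace ℝ (Fin 3)))) := by
  have hχu : AEStronglyMeasurable (uncurry fun τ y => χ y • u τ y) (volume.restrict (Ioo 0 t ×ˢ univ)) := by
    have h1 : AEStronglyMeasurable (fun p : ℝ × EuclideanSpace ℝ (Fin 3) => χ p.2) (volume.restrict (Ioo 0 t ×ˢ univ)) :=
      (hχm.comp measurable_snd).aestronglyMeasurable
    exact h1.smul hu
  have hχuU : ∀ τ ∈ Ioo 0 t, ∀ y, ‖χ y • u τ y‖ ≤ U := fun τ hτ y => by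
    rw [norm_smul, Real.norm_eq_abs]
    calc |χ y| * ‖u τ y‖ ≤ 1 * U := mul_le_mul (hχ1 y) (huU τ hτ y) (norm_nonneg _) zero_le_one
      _ = U := one_mul U
  have hi1 : Integrable (fun p : ℝ × EuclideanSpace ℝ (Fin 3) =>
      χ x • oseenKernel (1 * (t - p.1)) (x - p.2) (u p.1 p.2) (u p.1 p.2))
      ((volume.restrict (Ioo 0 t)).prod (volume : Measure (EuclideanSpace ℝ (Fin 3)))) :=
    (integrable_oseenKernel_fields one_pos ht.le hu hu huU huU hU hU x).smul (χ x)
  have hi2 := integrable_oseenKernel_fields one_pos ht.le hχu hχu hχuU hχuU hU hU x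
  rw [oseenDuhamel_eq_integral_prod_of_bound one_pos ht.le hu hu huU huU hU hU x,
    oseenDuhamel_eq_integral_prod_of_bound one_pos ht.le hχu hχu hχuU hχuU hU hU x, ← integral_smul,
    ← integral_sub hi1 hi2]
  refine integral_congr_ae (Eventually.of_forall fun p => ?_)
  simp only [oseenKernel_smul_left, oseenKernel_smul_right, smul_smul, sub_smul]

/-! ### The weight -/

/-- **THE WEIGHT SPLITS INTO A COMMUTATOR PART AND A TRANSITION PART**: for `0 ≤ χ ≤ 1`,
`|χ(x) − χ(y)²| ≤ |χ(x) − χ(y)| + χ(y)(1 − χ(y))`. [folklore] -/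
theorem abs_weight_le {χ : EuclideanSpace ℝ (Fin 3) → ℝ} (h0 : ∀ z, 0 ≤ χ z) (h1 : ∀ z, χ z ≤ 1)
    (x y : EuclideanSpace ℝ (Fin 3)) : |χ x - χ y * χ y| ≤ |χ x - χ y| + χ y * (1 - χ y) := by
  have h : χ x - χ y * χ y = (χ x - χ y) + χ y * (1 - χ y) := by ring
  rw [h]
  refine (abs_add_le _ _).trans (add_le_add le_rfl (le_of_eq (abs_of_nonneg ?_)))
  exact mul_nonneg (h0 y) (by linarith [h1 y])

/-- **POINTWISE MAJORANT OF THE COMMUTATOR INTEGRAND**: for `0 ≤ χ ≤ 1` that is `Lχ`-Lipschitz, a field with `‖u(τ,y)‖ ≤ A` and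
`‖u(τ,y)‖ ≤ η_c` wherever `0 < χ(y) < 1`, and `σ > 0`:
`‖(χ(x) − χ(y)²)·K(σ,x−y)[u,u]‖ ≤ k(σ,x−y)·(Lχ^{1/2}‖x−y‖^{1/2}·A² + η_c²)` (`|χ(x)−χ(y)| ≤ min(1, Lχ‖x−y‖) ≤ (Lχ‖x−y‖)^{1/2}`,
`χ(1−χ) ≤ 1` and vanishes off `{0 < χ < 1}`; Koch–Tataru's bound `‖K(σ,z)[a,b]‖ ≤ k(σ,z)‖a‖‖b‖`). [folklore] -/
theorem norm_weight_smul_oseenKernel_le {χ : EuclideanSpace ℝ (Fin 3) → ℝ} {Lχ A ηc σ : ℝ} {a : EuclideanSpace ℝ (Fin 3)}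
    (h0 : ∀ z, 0 ≤ χ z) (h1 : ∀ z, χ z ≤ 1) (hL : 0 ≤ Lχ) (hLip : ∀ x y, |χ x - χ y| ≤ Lχ * ‖x - y‖) (hσ : 0 < σ)
    (hA : ‖a‖ ≤ A) {y : EuclideanSpace ℝ (Fin 3)} (hquiet : 0 < χ y → χ y < 1 → ‖a‖ ≤ ηc) (x : EuclideanSpace ℝ (Fin 3)) :
    ‖(χ x - χ y * χ y) • oseenKernel σ (x - y) a a‖ ≤
      oseenMajorant (EuclideanSpace ℝ (Fin 3)) σ (x - y) * ((Lχ * ‖x - y‖) ^ (1 / 2 : ℝ) * A ^ 2 + ηc ^ 2) := by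
  have hA0 : 0 ≤ A := (norm_nonneg _).trans hA
  have hk0 : 0 ≤ oseenMajorant (EuclideanSpace ℝ (Fin 3)) σ (x - y) := oseenMajorant_nonneg hσ.le _
  have hK : ‖oseenKernel σ (x - y) a a‖ ≤ oseenMajorant (EuclideanSpace ℝ (Fin 3)) σ (x - y) * ‖a‖ * ‖a‖ :=
    norm_oseenKernel_le_oseenMajorant hσ _ _ _
  -- the commutator part
  have hcomm : |χ x - χ y| * (‖a‖ * ‖a‖) ≤ (Lχ * ‖x - y‖) ^ (1 / 2 : ℝ) * A ^ 2 := by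
    have hmin : |χ x - χ y| ≤ min 1 (Lχ * ‖x - y‖) := by
      refine le_min ?_ (hLip x y)
      rw [abs_le]; constructor <;> linarith [h0 x, h1 x, h0 y, h1 y]
    have hsq : ‖a‖ * ‖a‖ ≤ A ^ 2 := by rw [sq]; exact mul_le_mul hA hA (norm_nonneg _) hA0
    exact mul_le_mul (hmin.trans (min_one_le_rpow_half (by positivity))) hsq (by positivity) (by positivity)
  -- the transition part
  have htrans : χ y * (1 - χ y) * (‖a‖ * ‖a‖) ≤ ηc ^ 2 := by
    by_cases hy0 : 0 < χ y
    · by_cases hy1 : χ y < 1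
      · have hq := hquiet hy0 hy1
        have hηc : 0 ≤ ηc := (norm_nonneg _).trans hq
        have h2 : ‖a‖ * ‖a‖ ≤ ηc ^ 2 := by rw [sq]; exact mul_le_mul hq hq (norm_nonneg _) hηc
        have h3 : χ y * (1 - χ y) ≤ 1 := by nlinarith [h0 y, h1 y]
        calc χ y * (1 - χ y) * (‖a‖ * ‖a‖) ≤ 1 * ηc ^ 2 :=
              mul_le_mul h3 h2 (by positivity) zero_le_one
          _ = ηc ^ 2 := one_mul _
      · have : χ y = 1 := le_antisymm (h1 y) (not_lt.1 hy1)
        rw [this]; simp [sq_nonneg]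
    · have : χ y = 0 := le_antisymm (not_lt.1 hy0) (h0 y)
      rw [this]; simp [sq_nonneg]
  rw [norm_smul, Real.norm_eq_abs]
  calc |χ x - χ y * χ y| * ‖oseenKernel σ (x - y) a a‖
      ≤ (|χ x - χ y| + χ y * (1 - χ y)) * (oseenMajorant (EuclideanSpace ℝ (Fin 3)) σ (x - y) * ‖a‖ * ‖a‖) :=
        mul_le_mul (abs_weight_le h0 h1 x y) hK (norm_nonneg _)
          (add_nonneg (abs_nonneg _) (mul_nonneg (h0 y) (by linarith [h1 y])))
    _ = oseenMajorant (EuclideanSpace ℝ (Fin 3)) σ (x - y) *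
          (|χ x - χ y| * (‖a‖ * ‖a‖) + χ y * (1 - χ y) * (‖a‖ * ‖a‖)) := by ring
    _ ≤ oseenMajorant (EuclideanSpace ℝ (Fin 3)) σ (x - y) * ((Lχ * ‖x - y‖) ^ (1 / 2 : ℝ) * A ^ 2 + ηc ^ 2) :=
        mul_le_mul_of_nonneg_left (add_le_add hcomm htrans) hk0

/-! ### The slice integrals of the majorant -/

/-- The half-moment constant `C_K·m_{1/2} > 0`. [folklore] -/
theorem halfMomentConst_pos :
    0 < oseenKernelBoundConst (EuclideanSpace ℝ (Fin 3)) *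
      ∫ w : EuclideanSpace ℝ (Fin 3), (1 + ‖w‖ ^ 2) ^ (-(2 : ℝ)) * ‖w‖ ^ (1 / 2 : ℝ) := by
  refine mul_pos oseenKernelBoundConst_pos ?_
  refine (integral_pos_iff_support_of_nonneg (fun w => ?_) integrable_one_add_norm_sq_rpow_neg_two_mul_sqrt).2 ?_
  · exact mul_nonneg (Real.rpow_nonneg (by positivity) _) (Real.rpow_nonneg (norm_nonneg _) _)
  · have hsub : {w : EuclideanSpace ℝ (Fin 3) | w ≠ 0} ⊆
        support fun w : EuclideanSpace ℝ (Fin 3) => (1 + ‖w‖ ^ 2) ^ (-(2 : ℝ)) * ‖w‖ ^ (1 / 2 : ℝ) := by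
      intro w hw
      rw [mem_support]
      exact mul_ne_zero (Real.rpow_pos_of_pos (by positivity) _).ne'
        (Real.rpow_pos_of_pos (norm_pos_iff.2 hw) _).ne'
    refine lt_of_lt_of_le ?_ (measure_mono hsub)
    have : {w : EuclideanSpace ℝ (Fin 3) | w ≠ 0} = {(0 : EuclideanSpace ℝ (Fin 3))}ᶜ := by
      ext w; simp
    rw [this, measure_compl (measurableSet_singleton 0) (measure_singleton_lt_top.ne), measure_singleton, tsub_zero]
    simp

/-- **SLICE INTEGRAL OF THE MAJORANT WITH THE HALF WEIGHT, centred at `x`**: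
`∫ k(σ,x−y)‖x−y‖^{1/2} dy = C_K m_{1/2} σ^{−1/4}` (`σ > 0`). [folklore] -/
theorem integral_oseenMajorant_sub_mul_sqrt_norm {σ : ℝ} (hσ : 0 < σ) (x : EuclideanSpace ℝ (Fin 3)) :
    ∫ y : EuclideanSpace ℝ (Fin 3), oseenMajorant (EuclideanSpace ℝ (Fin 3)) σ (x - y) * ‖x - y‖ ^ (1 / 2 : ℝ) =
      oseenKernelBoundConst (EuclideanSpace ℝ (Fin 3)) *
        (∫ w : EuclideanSpace ℝ (Fin 3), (1 + ‖w‖ ^ 2) ^ (-(2 : ℝ)) * ‖w‖ ^ (1 / 2 : ℝ)) * σ ^ (-(1 / 4 : ℝ)) := by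
  rw [integral_sub_left_eq_self (fun z : EuclideanSpace ℝ (Fin 3) =>
    oseenMajorant (EuclideanSpace ℝ (Fin 3)) σ z * ‖z‖ ^ (1 / 2 : ℝ)) volume x]
  exact integral_oseenMajorant_mul_sqrt_norm hσ

/-- **SLICE INTEGRAL OF THE MAJORANT, centred at `x`**: `∫ k(σ,x−y) dy = m σ^{−1/2}` (`σ > 0`). [folklore] -/
theorem integral_oseenMajorant_sub {σ : ℝ} (hσ : 0 < σ) (x : EuclideanSpace ℝ (Fin 3)) :
    ∫ y : EuclideanSpace ℝ (Fin 3), oseenMajorant (EuclideanSpace ℝ (Fin 3)) σ (x - y) =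
      oseenMajorantMass (EuclideanSpace ℝ (Fin 3)) * σ ^ (-(1 / 2 : ℝ)) := by
  rw [integral_sub_left_eq_self (fun z : EuclideanSpace ℝ (Fin 3) => oseenMajorant (EuclideanSpace ℝ (Fin 3)) σ z) volume x]
  exact integral_oseenMajorant hσ

/-- `∫⁻_{(0,t)} (t−τ)^{−1/4} dτ = (4/3)·t^{3/4}` (`t > 0`). [folklore] -/
theorem setLIntegral_Ioo_sub_rpow_neg_quarter {t : ℝ} (ht : 0 < t) :
    ∫⁻ τ in Ioo 0 t, ENNReal.ofReal ((t - τ) ^ (-(1 / 4 : ℝ))) = ENNReal.ofReal (t ^ (3 / 4 : ℝ) / (3 / 4 : ℝ)) := by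
  have h := FujitaKato.lintegral_Ioc_sub_rpow (p := -(1 / 4 : ℝ)) (h := t) (t := t) (by norm_num) ht.le
  rw [sub_self] at h
  rw [restrict_Ioo_eq_restrict_Ioc, h]
  norm_num

/-! ### The sup bound -/

/-- **THE OSEEN COMMUTATOR IN SUP NORM**: there is an absolute `C₀ > 0` such that for every `t > 0`, every weight `χ` with
`0 ≤ χ ≤ 1` that is measurable and `Lχ`-Lipschitz, and every field `u` measurable on `(0,t) × ℝ³` with `‖u(τ,y)‖ ≤ A` there and
`‖u(τ,y)‖ ≤ η_c` wherever `0 < χ(y) < 1` (the quiet transition layer),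
`‖χ(x)·B₀(u,u)(t,x) − B₀(χu,χu)(t,x)‖ ≤ C₀·(Lχ^{1/2}·A²·t^{3/4} + η_c²·t^{1/2})` at EVERY `x`. [folklore] -/
theorem norm_oseenCommutator_le :
    ∃ C₀ : ℝ, 0 < C₀ ∧ ∀ (u : ℝ → EuclideanSpace ℝ (Fin 3) → EuclideanSpace ℝ (Fin 3)) (χ : EuclideanSpace ℝ (Fin 3) → ℝ)
      (t Lχ A ηc : ℝ), 0 < t → Measurable χ → (∀ z, 0 ≤ χ z) → (∀ z, χ z ≤ 1) → 0 ≤ Lχ →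
      (∀ x y, |χ x - χ y| ≤ Lχ * ‖x - y‖) →
      AEStronglyMeasurable (uncurry u) (volume.restrict (Ioo 0 t ×ˢ univ)) →
      (∀ τ ∈ Ioo 0 t, ∀ y, ‖u τ y‖ ≤ A) → 0 ≤ ηc →
      (∀ τ ∈ Ioo 0 t, ∀ y, 0 < χ y → χ y < 1 → ‖u τ y‖ ≤ ηc) →
      ∀ x, ‖χ x • oseenDuhamel 1 0 u u t x - oseenDuhamel 1 0 (fun τ y => χ y • u τ y) (fun τ y => χ y • u τ y) t x‖ ≤
        C₀ * (Lχ ^ (1 / 2 : ℝ) * A ^ 2 * t ^ (3 / 4 : ℝ) + ηc ^ 2 * t ^ (1 / 2 : ℝ)) := by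
  set H : ℝ := oseenKernelBoundConst (EuclideanSpace ℝ (Fin 3)) *
    ∫ w : EuclideanSpace ℝ (Fin 3), (1 + ‖w‖ ^ 2) ^ (-(2 : ℝ)) * ‖w‖ ^ (1 / 2 : ℝ) with hH
  have hHpos : 0 < H := halfMomentConst_pos
  set m : ℝ := oseenMajorantMass (EuclideanSpace ℝ (Fin 3)) with hm
  have hmpos : 0 < m := oseenMajorantMass_pos
  refine ⟨H * (4 / 3) + 2 * m, by positivity, ?_⟩
  intro u χ t Lχ A ηc ht hχm h0 h1 hL hLip hu huA hηc hquiet x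
  have hA0 : 0 ≤ A := (norm_nonneg _).trans (huA (t / 2) ⟨by linarith, by linarith⟩ 0)
  have hχ1 : ∀ y, |χ y| ≤ 1 := fun y => by rw [abs_le]; constructor <;> linarith [h0 y, h1 y]
  set μ : Measure (ℝ × EuclideanSpace ℝ (Fin 3)) := (volume.restrict (Ioo 0 t)).prod volume with hμ
  -- the commutator as one integral, and its integrand's majorant
  rw [oseenCommutator_eq_integral_prod ht hu hχm huA hA0 hχ1 x]
  set F : ℝ × EuclideanSpace ℝ (Fin 3) → EuclideanSpace ℝ (Fin 3) := fun p =>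
    (χ x - χ p.2 * χ p.2) • oseenKernel (1 * (t - p.1)) (x - p.2) (u p.1 p.2) (u p.1 p.2) with hF
  set G : ℝ × EuclideanSpace ℝ (Fin 3) → ℝ := fun p =>
    oseenMajorant (EuclideanSpace ℝ (Fin 3)) (t - p.1) (x - p.2) *
      ((Lχ * ‖x - p.2‖) ^ (1 / 2 : ℝ) * A ^ 2 + ηc ^ 2) with hG
  have hFG : ∀ p, p.1 ∈ Ioo 0 t → ‖F p‖ ≤ G p := by
    intro p hp
    have hσ : 0 < t - p.1 := sub_pos.2 hp.2
    have h := norm_weight_smul_oseenKernel_le (σ := t - p.1) h0 h1 hL hLip hσ (huA p.1 hp p.2)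
      (fun hy0 hy1 => hquiet p.1 hp p.2 hy0 hy1) x
    simpa only [hF, one_mul] using h
  -- Tonelli on the majorant
  have hGm : Measurable G := by
    have h1 : Measurable fun p : ℝ × EuclideanSpace ℝ (Fin 3) => oseenMajorant (EuclideanSpace ℝ (Fin 3)) (t - p.1) (x - p.2) :=
      measurable_oseenMajorant_uncurry.comp ((measurable_const.sub measurable_fst).prodMk (measurable_const.sub measurable_snd))
    have h2 : Measurable fun p : ℝ × EuclideanSpace ℝ (Fin 3) => (Lχ * ‖x - p.2‖) ^ (1 / 2 : ℝ) * A ^ 2 + ηc ^ 2 :=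
      (((measurable_const.mul (measurable_const.sub measurable_snd).norm).pow_const _).mul_const _).add_const _
    exact h1.mul h2
  have hslice : ∀ τ ∈ Ioo 0 t, ∫⁻ y, ENNReal.ofReal (G (τ, y)) =
      ENNReal.ofReal (Lχ ^ (1 / 2 : ℝ) * A ^ 2 * H * (t - τ) ^ (-(1 / 4 : ℝ)) + ηc ^ 2 * m * (t - τ) ^ (-(1 / 2 : ℝ))) := by
    intro τ hτ
    have hσ : 0 < t - τ := sub_pos.2 hτ.2
    have hi1 : Integrable fun y : EuclideanSpace ℝ (Fin 3) =>
        oseenMajorant (EuclideanSpace ℝ (Fin 3)) (t - τ) (x - y) * ‖x - y‖ ^ (1 / 2 : ℝ) :=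
      (integrable_oseenMajorant_mul_sqrt_norm hσ).comp_sub_left x
    have hi2 : Integrable fun y : EuclideanSpace ℝ (Fin 3) => oseenMajorant (EuclideanSpace ℝ (Fin 3)) (t - τ) (x - y) :=
      (integrable_oseenMajorant hσ).comp_sub_left x
    have hGτ : (fun y => G (τ, y)) = fun y =>
        (Lχ ^ (1 / 2 : ℝ) * A ^ 2) * (oseenMajorant (EuclideanSpace ℝ (Fin 3)) (t - τ) (x - y) * ‖x - y‖ ^ (1 / 2 : ℝ)) +
          ηc ^ 2 * oseenMajorant (EuclideanSpace ℝ (Fin 3)) (t - τ) (x - y) := by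
      funext y
      simp only [hG]
      rw [Real.mul_rpow hL (norm_nonneg _)]
      ring
    have hint : Integrable fun y => G (τ, y) := by
      rw [hGτ]; exact (hi1.const_mul _).add (hi2.const_mul _)
    have hnn : 0 ≤ᵐ[volume] fun y => G (τ, y) := Eventually.of_forall fun y => by
      simp only [hG]
      exact mul_nonneg (oseenMajorant_nonneg hσ.le _) (by positivity)
    rw [← ofReal_integral_eq_lintegral_ofReal hint hnn, hGτ, integral_add (hi1.const_mul _) (hi2.const_mul _),
      integral_const_mul, integral_const_mul, integral_oseenMajorant_sub_mul_sqrt_norm hσ x,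
      integral_oseenMajorant_sub hσ x]
    congr 1
    simp only [hH, hm]
    ring
  have hmeas1 : Measurable fun τ : ℝ => ENNReal.ofReal ((t - τ) ^ (-(1 / 4 : ℝ))) :=
    ((measurable_const.sub measurable_id).pow_const _).ennreal_ofReal
  have hmeas2 : Measurable fun τ : ℝ => ENNReal.ofReal ((t - τ) ^ (-(1 / 2 : ℝ))) :=
    ((measurable_const.sub measurable_id).pow_const _).ennreal_ofReal
  have hc1 : 0 ≤ Lχ ^ (1 / 2 : ℝ) * A ^ 2 * H := by positivity
  have hc2 : 0 ≤ ηc ^ 2 * m := by positivity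
  have hlin : ∫⁻ p, ENNReal.ofReal (G p) ∂μ ≤
      ENNReal.ofReal (Lχ ^ (1 / 2 : ℝ) * A ^ 2 * H * (t ^ (3 / 4 : ℝ) / (3 / 4 : ℝ)) +
        ηc ^ 2 * m * (2 * Real.sqrt (t - 0))) := by
    rw [hμ, lintegral_prod _ hGm.ennreal_ofReal.aemeasurable]
    calc ∫⁻ τ in Ioo 0 t, ∫⁻ y, ENNReal.ofReal (G (τ, y))
        = ∫⁻ τ in Ioo 0 t, (ENNReal.ofReal (Lχ ^ (1 / 2 : ℝ) * A ^ 2 * H) * ENNReal.ofReal ((t - τ) ^ (-(1 / 4 : ℝ))) +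
            ENNReal.ofReal (ηc ^ 2 * m) * ENNReal.ofReal ((t - τ) ^ (-(1 / 2 : ℝ)))) := by
          refine setLIntegral_congr_fun measurableSet_Ioo fun τ hτ => ?_
          have hσ : 0 < t - τ := sub_pos.2 hτ.2
          rw [hslice τ hτ, ENNReal.ofReal_add (by positivity) (by positivity),
            ENNReal.ofReal_mul hc1, ENNReal.ofReal_mul hc2]
      _ = ENNReal.ofReal (Lχ ^ (1 / 2 : ℝ) * A ^ 2 * H) * (∫⁻ τ in Ioo 0 t, ENNReal.ofReal ((t - τ) ^ (-(1 / 4 : ℝ)))) +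
            ENNReal.ofReal (ηc ^ 2 * m) * (∫⁻ τ in Ioo 0 t, ENNReal.ofReal ((t - τ) ^ (-(1 / 2 : ℝ)))) := by
          rw [lintegral_add_left (hmeas1.const_mul _), lintegral_const_mul _ hmeas1, lintegral_const_mul _ hmeas2]
      _ ≤ _ := le_of_eq (by
          rw [setLIntegral_Ioo_sub_rpow_neg_quarter ht, setLIntegral_Ioo_sub_rpow_neg_half_of_lt ht,
            ← ENNReal.ofReal_mul hc1, ← ENNReal.ofReal_mul hc2, ← ENNReal.ofReal_add (by positivity) (by positivity)])
  -- conclude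
  have hFle : ∫⁻ p, ‖F p‖ₑ ∂μ ≤ ∫⁻ p, ENNReal.ofReal (G p) ∂μ := by
    refine lintegral_mono_ae ?_
    have hae : ∀ᵐ p ∂μ, p.1 ∈ Ioo 0 t := by
      rw [hμ, Measure.restrict_prod_eq_prod_univ]
      filter_upwards [ae_restrict_mem (measurableSet_Ioo.prod MeasurableSet.univ)] with p hp
      exact hp.1
    filter_upwards [hae] with p hp
    rw [← ofReal_norm]
    exact ENNReal.ofReal_le_ofReal (hFG p hp)
  have htot : 0 ≤ Lχ ^ (1 / 2 : ℝ) * A ^ 2 * H * (t ^ (3 / 4 : ℝ) / (3 / 4 : ℝ)) + ηc ^ 2 * m * (2 * Real.sqrt (t - 0)) := by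
    positivity
  calc ‖∫ p, F p ∂μ‖ ≤ (∫⁻ p, ‖F p‖ₑ ∂μ).toReal := by
        have := norm_integral_le_lintegral_norm (μ := μ) F
        simpa only [ofReal_norm] using this
    _ ≤ (ENNReal.ofReal (Lχ ^ (1 / 2 : ℝ) * A ^ 2 * H * (t ^ (3 / 4 : ℝ) / (3 / 4 : ℝ)) +
          ηc ^ 2 * m * (2 * Real.sqrt (t - 0)))).toReal :=
        ENNReal.toReal_mono ENNReal.ofReal_ne_top (hFle.trans hlin)
    _ = Lχ ^ (1 / 2 : ℝ) * A ^ 2 * H * (t ^ (3 / 4 : ℝ) / (3 / 4 : ℝ)) + ηc ^ 2 * m * (2 * Real.sqrt (t - 0)) :=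
        ENNReal.toReal_ofReal htot
    _ = (H * (4 / 3)) * (Lχ ^ (1 / 2 : ℝ) * A ^ 2 * t ^ (3 / 4 : ℝ)) + (2 * m) * (ηc ^ 2 * t ^ (1 / 2 : ℝ)) := by
        rw [sub_zero, Real.sqrt_eq_rpow]; ring
    _ ≤ (H * (4 / 3) + 2 * m) * (Lχ ^ (1 / 2 : ℝ) * A ^ 2 * t ^ (3 / 4 : ℝ)) +
          (H * (4 / 3) + 2 * m) * (ηc ^ 2 * t ^ (1 / 2 : ℝ)) := by
        have ht1 : 0 ≤ Lχ ^ (1 / 2 : ℝ) * A ^ 2 * t ^ (3 / 4 : ℝ) := by positivity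
        have ht2 : 0 ≤ ηc ^ 2 * t ^ (1 / 2 : ℝ) := by positivity
        gcongr <;> linarith
    _ = (H * (4 / 3) + 2 * m) * (Lχ ^ (1 / 2 : ℝ) * A ^ 2 * t ^ (3 / 4 : ℝ) + ηc ^ 2 * t ^ (1 / 2 : ℝ)) := by ring

end Summit.NavierStokesRegularity.NavierStokesRegularity.Cruxes.TypeIQuantSubcubicExp.QuietCollar

end
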